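import Summits.ValiantsHypothesis.ValiantsHypothesis.Theorems.AnyonJetsJetConstantElimDefs
import Summits.ValiantsHypothesis.ValiantsHypothesis.Theorems.AnyonJetsJetConstantElimMultiplierBypassTwoAdic
import Mathlib.NumberTheory.Padics.PadicVal.Basic

/-!
# AnyonJets — crux `JetConstantElim` (stmt-ValiantsHypothesis-16737), line `birth`: the multiplier
# bypass over the NAMED predicates, and the caveat "when is the 2-adic conjunct free" as lemmas

With the vocabulary of `AnyonJetsJetConstantElimDefs.lean` (`CFUltAt c k`, `CEUltWith b`,
`CEUltTwoAdicWith b`, `IntegralMultipleTwoAdicWith b₁`; route-level statements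
`CF^ult := ∀ c ∃ k ≥ 1, CFUltAt c k`, `CE^ult₂ := ∃ b, CEUltTwoAdicWith b`,
`stub_integralMultiple₂ := ∃ b₁, IntegralMultipleTwoAdicWith b₁`), this file restates the landed
bypass (`…MultiplierBypass{,Boolean,Assembly,TwoAdic}.lean`) BY NAME, ready for a re-glued
`closes`:

* `closes_ult : CF^ult → CE^ult₂ → UniformJetUpperBound → ValiantsHypothesis`;
* `cfUlt_of_perModPowBooleanHard : PerModPowBooleanHard → CF^ult`;
* `ceUltTwoAdic_of : stub_algebraicDescent → stub_integralMultiple₂ → stub_signSimulation → CE^ult₂`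
  (the two outer stubs are landed theorems, so also `ceUltTwoAdic_of_integralMultipleTwoAdic :
  stub_integralMultiple₂ → CE^ult₂`);
* `valiant_of_perModPowBooleanHard_of_integralMultipleTwoAdicWith`,
  `jetExponentUnbounded_of_perModPowBooleanHard_of_integralMultipleTwoAdicWith`;
* sanity: `constantFreeJetGrowth_of_cfUlt` (`CF^ult → CF`), `ceUltTwoAdic_of_ceUlt`
  (`CE^ult → CE^ult₂`), `ceUltTwoAdic_of_jetConstantElim` (`CE → CE^ult₂`),
  `integralMultiple_of_integralMultipleTwoAdicWith` (`stub_integralMultiple₂ → stub_integralMultiple`).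

And the CAVEAT of the bypass as lemmas — when is the extra conjunct `v₂(M) ≤ (|Q|+n+2)^{b₁}` on the
integral normal form free? The multiplier produced by exponent balancing is `M = N^e` (`N` a common
denominator of the constants, `e` the denominator depth, up to `2^{|Q|}`):

* `padicValNat_two_pow_eq_zero_of_odd` — `N` odd ⇒ `v₂(N^e) = 0` for EVERY depth `e`
  (`integralMultipleTwoAdicWith_of_oddPow`: the registered stub with an odd-power multiplier
  implies `stub_integralMultiple₂` with the same exponent);
* `padicValNat_two_pow_le` — `v₂(N^e) ≤ e · log₂ N`: polynomial depth × height suffices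
  (`integralMultipleTwoAdicWith_of_shallowPow`);
* `padicValNat_two_towerOfHalves` — `v₂(2^{2^s}) = 2^s`: a tower of `s` squarings of `1/2` is
  exactly what is NOT absorbed (Koiran–Perifel 2011, Rem. 4: "divisions by two occur").

Honest framing: CONDITIONAL bookkeeping on OPEN statements (`PerModPowBooleanHard`,
`stub_integralMultiple₂`); nothing here proves them; VP ≠ VNP is NOT proved.

References: P. Bürgisser, *On defining integers …*, Comput. Complexity 18 (2009), §1, Thm. 2.10;
P. Koiran, S. Perifel, *Interpolation in Valiant's theory*, Comput. Complexity 20 (2011), Rem. 4.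
-/

noncomputable section

-- single-conjunct layout: Sub = Summit, duplicated namespace component intended
set_option linter.dupNamespace false

namespace Summit.ValiantsHypothesis.ValiantsHypothesis.Theorems.AnyonJets.JetConstantElim

open MvPolynomial Literature.Computability.AlgebraicComplexity
open Summit.ValiantsHypothesis.ValiantsHypothesis.Theses.AnyonJets
open Summit.ValiantsHypothesis.ValiantsHypothesis.Theorems.AnyonJets.ConstantFreeJetGrowth (jet)

/-! ### The bypass by name -/

/-- **`closes_ult : CF^ult → CE^ult₂ → U → VH`** (by name; = `closes_ultimate_twoAdic`). [folklore] -/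
theorem closes_ult (hCF : ∀ c : ℕ, ∃ k : ℕ, 1 ≤ k ∧ CFUltAt c k)
    (hCE : ∃ b : ℕ, CEUltTwoAdicWith b) (hU : UniformJetUpperBound) : _root_.ValiantsHypothesis :=
  closes_ultimate_twoAdic hCF hCE hU

/-- **`PerModPowBooleanHard → CF^ult`** (by name; = `cfUltimate_of_perModPowBooleanHard`).
[cite: Burgisser2000TCS, §5 (A3)] -/
theorem cfUlt_of_perModPowBooleanHard (hHard : PerModPowBooleanHard) :
    ∀ c : ℕ, ∃ k : ℕ, 1 ≤ k ∧ CFUltAt c k :=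
  cfUltimate_of_perModPowBooleanHard hHard

/-- **`stub_algebraicDescent → stub_integralMultiple₂ → stub_signSimulation → CE^ult₂`** (by name;
= `jetConstantElimUltimateTwoAdic_of`). [folklore] -/
theorem ceUltTwoAdic_of
    (hD : ∀ (σ : Type) (f : MvPolynomial σ ℤ),
      ∃ Q : Literature.Computability.AlgebraicComplexity.ArithCircuit (AlgebraicClosure ℚ) σ,
        Q.IsFanInTwo ∧
        Q.Computes (MvPolynomial.map (Int.castRingHom (AlgebraicClosure ℚ)) f) ∧
        Q.size ≤ Literature.Computability.AlgebraicComplexity.complexity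
          (MvPolynomial.map (Int.castRingHom ℂ) f))
    (hI : ∃ b₁ : ℕ, IntegralMultipleTwoAdicWith b₁)
    (hS : ∃ b₂ : ℕ, ∀ (σ : Type) (f : MvPolynomial σ ℤ)
      (P : Literature.Computability.AlgebraicComplexity.ArithCircuit ℤ σ) (t : ℕ),
      P.IsFanInTwo → P.Computes f →
      ((∀ g ∈ P.gates, ∀ u ∈ g.args, ∀ c : ℤ, u = .const c → c.natAbs ≤ 2 ^ t) ∧
        (∀ args : List (ℤ × Literature.Computability.AlgebraicComplexity.ArithCircuit.Operand ℤ σ),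
          Literature.Computability.AlgebraicComplexity.ArithCircuit.Gate.sum args ∈ P.gates →
            ∀ a ∈ args, a.1.natAbs ≤ 2 ^ t) ∧
        (∀ c : ℤ, P.output = .const c → c.natAbs ≤ 2 ^ t)) →
      Literature.Computability.AlgebraicComplexity.constantFreeComplexity f ≤ (P.size + t + 2) ^ b₂) :
    ∃ b : ℕ, CEUltTwoAdicWith b :=
  jetConstantElimUltimateTwoAdic_of hD hI hS

/-- **`stub_integralMultiple₂ → CE^ult₂`**, the outer stubs discharged by the landed theorems
`stub_algebraicDescent` (p575059) and `stub_signSimulation` (p575638). [folklore] -/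
theorem ceUltTwoAdic_of_integralMultipleTwoAdic (hI : ∃ b₁ : ℕ, IntegralMultipleTwoAdicWith b₁) :
    ∃ b : ℕ, CEUltTwoAdicWith b :=
  ceUltTwoAdic_of stub_algebraicDescent hI stub_signSimulation

/-- **Route AnyonJets on two named hypotheses**: `PerModPowBooleanHard → stub_integralMultiple₂ →
VP_ℂ ≠ VNP_ℂ`. CONDITIONAL: both open. [folklore] -/
theorem valiant_of_perModPowBooleanHard_of_integralMultipleTwoAdicWith
    (hHard : PerModPowBooleanHard) (hI : ∃ b₁ : ℕ, IntegralMultipleTwoAdicWith b₁) :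
    _root_.ValiantsHypothesis :=
  closes_ult (cfUlt_of_perModPowBooleanHard hHard) (ceUltTwoAdic_of_integralMultipleTwoAdic hI)
    uniformJetUpperBound_proof

/-- **The route's target on two named hypotheses**: `PerModPowBooleanHard →
stub_integralMultiple₂ → JetExponentUnbounded`. CONDITIONAL. [folklore] -/
theorem jetExponentUnbounded_of_perModPowBooleanHard_of_integralMultipleTwoAdicWith
    (hHard : PerModPowBooleanHard) (hI : ∃ b₁ : ℕ, IntegralMultipleTwoAdicWith b₁) :
    JetExponentUnbounded :=
  jetExponentUnbounded_of_ultimate_twoAdic (cfUlt_of_perModPowBooleanHard hHard)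
    (ceUltTwoAdic_of_integralMultipleTwoAdic hI)

/-! ### Sanity: how the named statements sit against the filed ones -/

/-- `CF^ult → ConstantFreeJetGrowth` (`M = 1`). [folklore] -/
theorem constantFreeJetGrowth_of_cfUlt (hCF : ∀ c : ℕ, ∃ k : ℕ, 1 ≤ k ∧ CFUltAt c k) :
    ConstantFreeJetGrowth :=
  cfGrowth_of_ultimate hCF

/-- `CE^ult → CE^ult₂` (`v₂ ≤ log₂`). [folklore] -/
theorem ceUltTwoAdic_of_ceUlt (h : ∃ b : ℕ, CEUltWith b) : ∃ b : ℕ, CEUltTwoAdicWith b :=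
  jetConstantElimUltimateTwoAdic_of_ultimate h

/-- `CE → CE^ult₂` (`M = 1`). [folklore] -/
theorem ceUltTwoAdic_of_jetConstantElim (h : JetConstantElim) : ∃ b : ℕ, CEUltTwoAdicWith b :=
  jetConstantElimUltimateTwoAdic_of_ultimate (jetConstantElimUltimate_of_jetConstantElim h)

/-- `stub_integralMultiple₂ → stub_integralMultiple` (drop the 2-adic conjunct; the registered
signature verbatim on the right). [folklore] -/
theorem integralMultiple_of_integralMultipleTwoAdicWith (hI : ∃ b₁ : ℕ, IntegralMultipleTwoAdicWith b₁) :
    let J := fun (n k : ℕ) => (∑ σ : Equiv.Perm (Fin n), MvPolynomial.C (((Equiv.Perm.sign σ : ℤˣ) : ℤ) * (((Finset.univ.filter (fun p : Fin n × Fin n => p.1 < p.2 ∧ σ p.2 < σ p.1)).card.choose k : ℕ) : ℤ)) * ∏ i : Fin n, MvPolynomial.X (σ i, i) : MvPolynomial (Fin n × Fin n) ℤ);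
    ∃ b₁ : ℕ, ∀ n k : ℕ, k ≤ Nat.log 2 n →
      ∀ Q : Literature.Computability.AlgebraicComplexity.ArithCircuit (AlgebraicClosure ℚ) (Fin n × Fin n),
        Q.IsFanInTwo →
        Q.Computes (MvPolynomial.map (Int.castRingHom (AlgebraicClosure ℚ)) (J n k)) →
        ∃ (P : Literature.Computability.AlgebraicComplexity.ArithCircuit ℤ (Fin n × Fin n)) (t M : ℕ),
          1 ≤ M ∧ P.IsFanInTwo ∧ P.Computes ((M : ℤ) • J n k) ∧
          ((∀ g ∈ P.gates, ∀ u ∈ g.args, ∀ c : ℤ, u = .const c → c.natAbs ≤ 2 ^ t) ∧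
            (∀ args : List (ℤ × Literature.Computability.AlgebraicComplexity.ArithCircuit.Operand ℤ (Fin n × Fin n)),
              Literature.Computability.AlgebraicComplexity.ArithCircuit.Gate.sum args ∈ P.gates →
                ∀ a ∈ args, a.1.natAbs ≤ 2 ^ t) ∧
            (∀ c : ℤ, P.output = .const c → c.natAbs ≤ 2 ^ t)) ∧
          P.size + t + 2 ≤ (Q.size + n + 2) ^ b₁ := by
  obtain ⟨b₁, hb⟩ := hI
  refine ⟨b₁, fun n k hk Q hQ2 hQc => ?_⟩
  obtain ⟨P, t, M, hM, hP2, hPc, hPb, hPs, -⟩ := hb n k hk Q hQ2 hQc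
  exact ⟨P, t, M, hM, hP2, hPc, hPb, hPs⟩

/-! ### The caveat as lemmas: when is the 2-adic conjunct free? -/

/-- **Odd denominators are free**: `v₂(N^e) = 0` for `N` odd and every depth `e`. [folklore] -/
theorem padicValNat_two_pow_eq_zero_of_odd {N : ℕ} (hN : Odd N) (e : ℕ) :
    padicValNat 2 (N ^ e) = 0 :=
  padicValNat.eq_zero_of_not_dvd fun h => hN.not_two_dvd_nat (Nat.prime_two.dvd_of_dvd_pow h)

/-- **Shallow towers are free**: `v₂(N^e) ≤ e · log₂ N` — a multiplier `N^e` of polynomial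
denominator DEPTH `e` over a denominator of polynomial HEIGHT has polynomial 2-adic valuation.
[folklore] -/
theorem padicValNat_two_pow_le (N e : ℕ) : padicValNat 2 (N ^ e) ≤ e * Nat.log 2 N := by
  rw [padicValNat.pow]
  exact Nat.mul_le_mul_left _ (padicValNat_le_nat_log N)

/-- **Deep towers of `1/2` are NOT free**: `v₂(2^{2^s}) = 2^s` — `s` squarings of the constant
`1/2` produce a multiplier of exponential 2-adic depth, the one thing the Boolean shadow does not
absorb (Koiran–Perifel 2011, Rem. 4: "divisions by two occur"). [cite: KoiranPerifel2011, Rem. 4] -/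
theorem padicValNat_two_towerOfHalves (s : ℕ) : padicValNat 2 (2 ^ 2 ^ s) = 2 ^ s :=
  padicValNat.prime_pow _

/-- **`stub_integralMultiple` with an ODD-POWER multiplier ⇒ `stub_integralMultiple₂`** (same
exponent): if the integral normal form can be achieved with `M = N^e`, `N` odd (e.g. all constants
algebraic integers up to odd denominators), the 2-adic conjunct holds trivially. [folklore] -/
theorem integralMultipleTwoAdicWith_of_oddPow (b₁ : ℕ)
    (h : ∀ n k : ℕ, k ≤ Nat.log 2 n →
      ∀ Q : Literature.Computability.AlgebraicComplexity.ArithCircuit (AlgebraicClosure ℚ) (Fin n × Fin n),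
        Q.IsFanInTwo →
        Q.Computes (MvPolynomial.map (Int.castRingHom (AlgebraicClosure ℚ)) (jet n k)) →
        ∃ (P : Literature.Computability.AlgebraicComplexity.ArithCircuit ℤ (Fin n × Fin n)) (t M : ℕ),
          1 ≤ M ∧ P.IsFanInTwo ∧ P.Computes ((M : ℤ) • jet n k) ∧
          ((∀ g ∈ P.gates, ∀ u ∈ g.args, ∀ c : ℤ, u = .const c → c.natAbs ≤ 2 ^ t) ∧
            (∀ args : List (ℤ × Literature.Computability.AlgebraicComplexity.ArithCircuit.Operand ℤ (Fin n × Fin n)),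
              Literature.Computability.AlgebraicComplexity.ArithCircuit.Gate.sum args ∈ P.gates →
                ∀ a ∈ args, a.1.natAbs ≤ 2 ^ t) ∧
            (∀ c : ℤ, P.output = .const c → c.natAbs ≤ 2 ^ t)) ∧
          P.size + t + 2 ≤ (Q.size + n + 2) ^ b₁ ∧ ∃ N e : ℕ, Odd N ∧ M = N ^ e) :
    IntegralMultipleTwoAdicWith b₁ := by
  intro n k hk Q hQ2 hQc
  obtain ⟨P, t, M, hM, hP2, hPc, hPb, hPs, N, e, hN, rfl⟩ := h n k hk Q hQ2 hQc
  refine ⟨P, t, N ^ e, hM, hP2, hPc, hPb, hPs, ?_⟩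
  rw [padicValNat_two_pow_eq_zero_of_odd hN]
  exact Nat.zero_le _

/-- **`stub_integralMultiple` with a SHALLOW-POWER multiplier ⇒ `stub_integralMultiple₂`**
(exponent doubled): if the multiplier is `M = N^e` with `e · log₂ N ≤ (|Q| + n + 2)^{b₁}`
(polynomial denominator depth times height — the regime of circuits of polynomial formal degree
over constants of polynomial height), then `v₂(M) ≤ (|Q|+n+2)^{b₁}` and the 2-adic conjunct holds.
[folklore] -/
theorem integralMultipleTwoAdicWith_of_shallowPow (b₁ : ℕ)
    (h : ∀ n k : ℕ, k ≤ Nat.log 2 n →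
      ∀ Q : Literature.Computability.AlgebraicComplexity.ArithCircuit (AlgebraicClosure ℚ) (Fin n × Fin n),
        Q.IsFanInTwo →
        Q.Computes (MvPolynomial.map (Int.castRingHom (AlgebraicClosure ℚ)) (jet n k)) →
        ∃ (P : Literature.Computability.AlgebraicComplexity.ArithCircuit ℤ (Fin n × Fin n)) (t M : ℕ),
          1 ≤ M ∧ P.IsFanInTwo ∧ P.Computes ((M : ℤ) • jet n k) ∧
          ((∀ g ∈ P.gates, ∀ u ∈ g.args, ∀ c : ℤ, u = .const c → c.natAbs ≤ 2 ^ t) ∧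
            (∀ args : List (ℤ × Literature.Computability.AlgebraicComplexity.ArithCircuit.Operand ℤ (Fin n × Fin n)),
              Literature.Computability.AlgebraicComplexity.ArithCircuit.Gate.sum args ∈ P.gates →
                ∀ a ∈ args, a.1.natAbs ≤ 2 ^ t) ∧
            (∀ c : ℤ, P.output = .const c → c.natAbs ≤ 2 ^ t)) ∧
          P.size + t + 2 ≤ (Q.size + n + 2) ^ b₁ ∧
          ∃ N e : ℕ, M = N ^ e ∧ e * Nat.log 2 N ≤ (Q.size + n + 2) ^ b₁) :
    IntegralMultipleTwoAdicWith b₁ := by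
  intro n k hk Q hQ2 hQc
  obtain ⟨P, t, M, hM, hP2, hPc, hPb, hPs, N, e, rfl, hd⟩ := h n k hk Q hQ2 hQc
  exact ⟨P, t, N ^ e, hM, hP2, hPc, hPb, hPs, (padicValNat_two_pow_le N e).trans hd⟩

end Summit.ValiantsHypothesis.ValiantsHypothesis.Theorems.AnyonJets.JetConstantElim

end
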